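import Literature.MathematicalPhysics.KineticTheory.ZeroWavenumberTransportRegularity
import Literature.MathematicalPhysics.KineticTheory.ZeroWavenumberDataOfClustering
import Literature.MathematicalPhysics.KineticTheory.FluctuationStrongContinuityGenerators
import Literature.MathematicalPhysics.KineticTheory.ChainMixingClustering
import Mathlib.Analysis.Normed.Group.FunctionSeries
import HarnessLib

/-!
# Transport regularity of a regular state from `ρ`-mixing and fixed-time `L²` locality

Topic `Literature/MathematicalPhysics/KineticTheory` (assembly companion of
`ZeroWavenumberTransportRegularity`, `ZeroWavenumberDataOfClustering`,
`FluctuationStrongContinuityGenerators`, `ChainMixingClustering`). For the infinite chain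
`P : OscillatorChain` (`U ≥ 0` measurable, `V` an even non-negative polynomial of degree `≥ 2`), a
dynamics `D` with carrier Buttà–Marchioro's good set `𝒳₀` which is the identity off `𝒳₀`, and a
shift-invariant state `μ` with BM's superstability estimate (2.3) preserved by `D`, the two analytic
inputs

* (M) exponential `ρ`-mixing of `μ` between half-lines (the registered form), and
* (L) fixed-time `L²(μ)` locality of the evolved generators `j₀ ∘ φ_t`, `h₀ ∘ φ_t`, uniformly on
  compact time intervals, with a summable rate (`hloc`: approximants depending on the sites of
  `[-n-1, n+1]`, error `ε_n`, `Σ ε_n < ∞`),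

give (§2) the summable clustering of every pair of generators `(a ∘ τ_x) ∘ φ_s`
(`integrable_cov_generators`, the hypothesis of `exists_zeroWavenumberData_of_clustering`) and
(§3), together with the continuity in time of the two-point functions, the continuity of the summed
autocorrelations `t ↦ Σ_x Cov_μ(a, (a ∘ φ_t) ∘ τ_x)` (`continuous_integral_count_cov_flow`, the
hypothesis of `ZeroWavenumberData.isStronglyContinuous_of_generators`). §4 assembles: for a DLR
Gibbs state in a regular class with at most one element and `C_μ(0) > 0`, the summed current
autocorrelation converges absolutely at every time and the Abel functional
`∫₀^∞ e^{-νt} C_μ(t) dt` is positive for every `ν > 0` (`transportRegular_of_mixing_of_locality`).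
Everything is proved; tagged `[folklore]`. No definitions, no named facts.
-/

noncomputable section

open MeasureTheory ProbabilityTheory Filter Set Function
open scoped Topology

namespace Literature.MathematicalPhysics.KineticTheory.HeatConduction

/-! ### §1 The generators `j₀`, `h₀`: locality, measurability, moments -/

namespace OscillatorChain

variable (P : OscillatorChain)

/-- The bond current `j₀` depends on the sites `0, 1` only, hence on `[-1, 1]`. [folklore] -/
theorem dependsOn_bondCurrentZ_zero : DependsOn (fun σ : ChainConfig => P.bondCurrentZ σ 0) (Icc (-1 : ℤ) 1) := by
  intro σ σ' h
  have h0 : σ 0 = σ' 0 := h 0 ⟨by norm_num, by norm_num⟩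
  have h1 : σ (0 + 1) = σ' (0 + 1) := h (0 + 1) ⟨by norm_num, by norm_num⟩
  simp only [bondCurrentZ, h0, h1]

/-- The energy density `h₀` depends on the sites `-1, 0, 1` only. [folklore] -/
theorem dependsOn_energyDensityZ_zero :
    DependsOn (fun σ : ChainConfig => P.energyDensityZ σ 0) (Icc (-1 : ℤ) 1) := by
  intro σ σ' h
  have h0 : σ 0 = σ' 0 := h 0 ⟨by norm_num, by norm_num⟩
  have h1 : σ (0 + 1) = σ' (0 + 1) := h (0 + 1) ⟨by norm_num, by norm_num⟩
  have h2 : σ (0 - 1) = σ' (0 - 1) := h (0 - 1) ⟨by norm_num, by norm_num⟩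
  simp only [energyDensityZ, h0, h1, h2]

end OscillatorChain

namespace InfiniteChainDynamics

variable {P : OscillatorChain} (D : InfiniteChainDynamics P)

/-! ### §2 Summable clustering of the generator pairs from (M) + (L) -/

/-- **Reduction of a generator pair.** For a flow commuting everywhere with the translations and
satisfying the group law everywhere (a `𝒳₀`-dynamics which is the identity off `𝒳₀`), and `μ`
preserved by `D`:
`Cov_μ((a ∘ τ_y) ∘ φ_s, ((b ∘ τ_z) ∘ φ_u) ∘ τ_x) = Cov_μ(a ∘ τ_y, (b ∘ φ_{u-s}) ∘ τ_{z+x})`. [folklore] -/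
theorem cov_generator_pair_eq (hcar : D.carrier = P.bmGood)
    (hid : ∀ (t : ℝ) (σ : ChainConfig), σ ∉ P.bmGood → D.flow t σ = σ) (hU0 : ∀ r, 0 ≤ P.U r)
    (hV0 : ∀ r, 0 ≤ P.V r) {μ : Measure ChainConfig} (hD : D.PreservesMeasure μ)
    {a b : ChainConfig → ℝ} (ha : Measurable a) (hb : Measurable b) (y z x : ℤ) (s u : ℝ) :
    cov[(a ∘ chainShift y) ∘ D.flow s, ((b ∘ chainShift z) ∘ D.flow u) ∘ chainShift x; μ] =
      cov[a ∘ chainShift y, (b ∘ D.flow (u - s)) ∘ chainShift (z + x); μ] := by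
  have hpt : ((b ∘ chainShift z) ∘ D.flow u) ∘ chainShift x =
      ((b ∘ D.flow (u - s)) ∘ chainShift (z + x)) ∘ D.flow s := by
    funext σ
    simp only [comp_apply]
    rw [D.flow_chainShift_of_eq_id hcar hid hU0 hV0 u x σ, ← ShiftAction.apply_add,
      D.flow_chainShift_of_eq_id hcar hid hU0 hV0 (u - s) (z + x) (D.flow s σ),
      ← D.flow_add_of_eq_id hcar hid (u - s) s σ, sub_add_cancel]
  rw [hpt]
  exact covariance_comp_measurePreserving (hD.2 s)
    ((ha.comp (chainShift.measurable y)).aestronglyMeasurable)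
    (((hb.comp (hD.2 (u - s)).measurable).comp (chainShift.measurable (z + x))).aestronglyMeasurable)

/-- **Summable clustering of the generator pairs from (M) + (L).** Let `U ≥ 0` be measurable and
`V` an even non-negative polynomial of degree `≥ 2`; let `D` have carrier `𝒳₀` and be the identity
off `𝒳₀`; let `μ` be shift-invariant, satisfy BM's (2.3) and be preserved by `D`. Assume (M)
exponential `ρ`-mixing of `μ` between half-lines (constants `C ≥ 0`, `m > 0`) and (L) `L²(μ)`
locality of `a ∘ φ_t` for `a ∈ {j₀, h₀}`, uniformly on `|t| ≤ τ`, with summable rate. Then every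
pair of generators `(a ∘ τ_y) ∘ φ_s`, `(b ∘ τ_z) ∘ φ_u` has summable truncated correlations:
`x ↦ Cov_μ((a ∘ τ_y) ∘ φ_s, ((b ∘ τ_z) ∘ φ_u) ∘ τ_x)` is integrable for the counting measure (the
hypothesis `hclust` of `exists_zeroWavenumberData_of_clustering`). [folklore] -/
theorem integrable_cov_generators {s₂ : ℕ} (h₂ : 1 ≤ s₂) (hU0 : ∀ r, 0 ≤ P.U r)
    (hUm : Measurable P.U) (hV : OscillatorChain.IsEvenPolyOfDegree P.V s₂)
    (hcar : D.carrier = P.bmGood)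
    (hid : ∀ (t : ℝ) (σ : ChainConfig), σ ∉ P.bmGood → D.flow t σ = σ)
    {μ : Measure ChainConfig} (hS : IsShiftInvariant μ) (hss : P.HasSuperstabilityEstimate μ)
    (hD : D.PreservesMeasure μ) {C m : ℝ} (hC : 0 ≤ C) (hm : 0 < m)
    (hmix : ∀ (a : ℤ) (n : ℕ) (f g : ChainConfig → ℝ),
      DependsOn f {i : ℤ | i ≤ a} → DependsOn g {i : ℤ | a + n ≤ i} → Measurable f → Measurable g →
      MemLp f 2 μ → MemLp g 2 μ →
      |∫ σ, f σ * g σ ∂μ - (∫ σ, f σ ∂μ) * ∫ σ, g σ ∂μ| ≤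
        C * Real.exp (-(m * n)) * (∫ σ, f σ ^ 2 ∂μ) ^ (1 / 2 : ℝ) * (∫ σ, g σ ^ 2 ∂μ) ^ (1 / 2 : ℝ))
    (hloc : ∀ a ∈ ({fun σ => P.bondCurrentZ σ 0, fun σ => P.energyDensityZ σ 0} : Set (ChainConfig → ℝ)),
      ∀ τ : ℝ, 0 ≤ τ → ∃ ε : ℕ → ℝ, (∀ n, 0 ≤ ε n) ∧ Summable ε ∧ ∀ t : ℝ, |t| ≤ τ → ∀ n : ℕ,
        ∃ g : ChainConfig → ℝ, DependsOn g (Icc (-(n : ℤ) - 1) (n + 1)) ∧ Measurable g ∧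
          MemLp g 2 μ ∧ Real.sqrt (∫ σ, (a (D.flow t σ) - g σ) ^ 2 ∂μ) ≤ ε n) :
    ∀ a ∈ {b : ChainConfig → ℝ |
        ∃ a ∈ ({fun σ => P.bondCurrentZ σ 0, fun σ => P.energyDensityZ σ 0} : Set (ChainConfig → ℝ)),
          ∃ (x : ℤ) (s : ℝ), b = (a ∘ chainShift x) ∘ D.flow s},
      ∀ b ∈ {b : ChainConfig → ℝ |
        ∃ a ∈ ({fun σ => P.bondCurrentZ σ 0, fun σ => P.energyDensityZ σ 0} : Set (ChainConfig → ℝ)),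
          ∃ (x : ℤ) (s : ℝ), b = (a ∘ chainShift x) ∘ D.flow s},
      Integrable (fun x : ℤ => cov[a, b ∘ chainShift x; μ]) (Measure.count : Measure ℤ) := by
  haveI : IsProbabilityMeasure μ := hss.1
  have hV0 : ∀ r, 0 ≤ P.V r := hV.choose_spec.2.2
  have hVm : Measurable P.V := hV.continuous.measurable
  have hτ : ∀ x : ℤ, MeasurePreserving (chainShift x) μ μ := hS.measurePreserving_chainShift
  -- the generators: measurable, local, square integrable
  have hgenM : ∀ a ∈ ({fun σ => P.bondCurrentZ σ 0, fun σ => P.energyDensityZ σ 0} :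
      Set (ChainConfig → ℝ)), Measurable a ∧ DependsOn a (Icc (-1 : ℤ) 1) ∧ MemLp a 2 μ := by
    intro a ha
    rcases ha with rfl | rfl
    · exact ⟨measurable_bondCurrentZ P 0, P.dependsOn_bondCurrentZ_zero,
        hss.memLp_bondCurrentZ h₂ hU0 hUm hV 0 ENNReal.ofNat_ne_top⟩
    · exact ⟨P.measurable_energyDensityZ hUm hVm 0, P.dependsOn_energyDensityZ_zero,
        hss.memLp_energyDensityZ hU0 hV0 hUm hVm 0 ENNReal.ofNat_ne_top⟩
  rintro a ⟨a₁, ha₁, y, s, rfl⟩ b ⟨b₁, hb₁, z, u, rfl⟩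
  obtain ⟨ha₁m, ha₁d, ha₁2⟩ := hgenM a₁ ha₁
  obtain ⟨hb₁m, -, hb₁2⟩ := hgenM b₁ hb₁
  -- reduction to `Cov_μ(a₁ ∘ τ_y, (b₁ ∘ φ_{u-s}) ∘ τ_{z+x})`
  have hred : (fun x : ℤ => cov[(a₁ ∘ chainShift y) ∘ D.flow s,
      ((b₁ ∘ chainShift z) ∘ D.flow u) ∘ chainShift x; μ]) =
      fun x : ℤ => cov[a₁ ∘ chainShift y, (b₁ ∘ D.flow (u - s)) ∘ chainShift (z + x); μ] :=
    funext fun x => D.cov_generator_pair_eq hcar hid hU0 hV0 hD ha₁m hb₁m y z x s u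
  rw [hred]
  -- the local observable `f = a₁ ∘ τ_y`
  set R : ℕ := y.natAbs + 1 with hR
  have hf : DependsOn (a₁ ∘ chainShift y) (Icc (-(R : ℤ)) R) := by
    refine (dependsOn_comp_chainShift_Icc ha₁d y).mono fun i hi => ?_
    simp only [mem_Icc] at hi ⊢
    constructor <;> omega
  have hfm : Measurable (a₁ ∘ chainShift y) := ha₁m.comp (chainShift.measurable y)
  have hf2 : MemLp (a₁ ∘ chainShift y) 2 μ := ha₁2.comp_measurePreserving (hτ y)
  -- the quasi-local observable `g = b₁ ∘ φ_{u-s}` and its approximants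
  have hg2 : MemLp (b₁ ∘ D.flow (u - s)) 2 μ := hb₁2.comp_measurePreserving (hD.2 (u - s))
  obtain ⟨ε, hε0, hε, happrox⟩ := hloc b₁ hb₁ |u - s| (abs_nonneg _)
  have h := happrox (u - s) le_rfl
  choose gloc hdep hglm hgl2 happ using h
  have hint : Integrable (fun w : ℤ => cov[a₁ ∘ chainShift y, (b₁ ∘ D.flow (u - s)) ∘ chainShift w; μ])
      (Measure.count : Measure ℤ) :=
    integrable_count_covariance_comp_chainShift hτ hC hm hmix (R := R) (R' := 1) hε0 hε hf hfm hf2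
      hg2 hdep hglm hgl2 happ
  -- translate the summation index by `z`
  rw [integrable_count_iff] at hint ⊢
  exact (Equiv.summable_iff (Equiv.addLeft z)).2 hint

/-! ### §3 Continuity of the summed autocorrelations from (M) + (L) + termwise continuity -/

/-- **A uniform summable majorant for the truncated autocorrelations.** Under (M) and (L) for the
generator `a` (depending on the sites of `[-1, 1]`): for every `τ ≥ 0` there is a summable
`F : ℤ → ℝ` with `|Cov_μ(a, (a ∘ φ_t) ∘ τ_w)| ≤ F(w)` for all `|t| ≤ τ`, `w ∈ ℤ`. [folklore] -/
theorem exists_summable_majorant_cov_flow {μ : Measure ChainConfig} [IsProbabilityMeasure μ]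
    (hτ : ∀ x : ℤ, MeasurePreserving (chainShift x) μ μ) (hD : D.PreservesMeasure μ)
    {C m : ℝ} (hC : 0 ≤ C) (hm : 0 < m)
    (hmix : ∀ (a : ℤ) (n : ℕ) (f g : ChainConfig → ℝ),
      DependsOn f {i : ℤ | i ≤ a} → DependsOn g {i : ℤ | a + n ≤ i} → Measurable f → Measurable g →
      MemLp f 2 μ → MemLp g 2 μ →
      |∫ σ, f σ * g σ ∂μ - (∫ σ, f σ ∂μ) * ∫ σ, g σ ∂μ| ≤
        C * Real.exp (-(m * n)) * (∫ σ, f σ ^ 2 ∂μ) ^ (1 / 2 : ℝ) * (∫ σ, g σ ^ 2 ∂μ) ^ (1 / 2 : ℝ))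
    {a : ChainConfig → ℝ} (ham : Measurable a) (had : DependsOn a (Icc (-1 : ℤ) 1)) (ha2 : MemLp a 2 μ)
    {τ : ℝ}
    (hloc : ∃ ε : ℕ → ℝ, (∀ n, 0 ≤ ε n) ∧ Summable ε ∧ ∀ t : ℝ, |t| ≤ τ → ∀ n : ℕ,
        ∃ g : ChainConfig → ℝ, DependsOn g (Icc (-(n : ℤ) - 1) (n + 1)) ∧ Measurable g ∧
          MemLp g 2 μ ∧ Real.sqrt (∫ σ, (a (D.flow t σ) - g σ) ^ 2 ∂μ) ≤ ε n) :
    ∃ F : ℤ → ℝ, Summable F ∧ ∀ t : ℝ, |t| ≤ τ → ∀ w : ℤ,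
      |cov[a, (a ∘ D.flow t) ∘ chainShift w; μ]| ≤ F w := by
  obtain ⟨ε, hε0, hε, happrox⟩ := hloc
  have hf : DependsOn a (Icc (-((1 : ℕ) : ℤ)) (1 : ℕ)) := by simpa using had
  obtain ⟨F, hF, hbound⟩ := exists_summable_clustering_majorant hτ hC hm hmix 1 1 hε0 hε
    (Real.sqrt_nonneg (∫ σ, a σ ^ 2 ∂μ)) (Real.sqrt_nonneg (∫ σ, a σ ^ 2 ∂μ))
  refine ⟨F, hF, fun t ht w => ?_⟩
  have h := happrox t ht
  choose gloc hdep hglm hgl2 happ using h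
  have hg2 : MemLp (a ∘ D.flow t) 2 μ := ha2.comp_measurePreserving (hD.2 t)
  have hgM : Real.sqrt (∫ σ, (a ∘ D.flow t) σ ^ 2 ∂μ) ≤ Real.sqrt (∫ σ, a σ ^ 2 ∂μ) :=
    Real.sqrt_le_sqrt (integral_sq_comp_eq (hD.2 t) ha2.aestronglyMeasurable).le
  exact hbound a (a ∘ D.flow t) gloc hf ham ha2 le_rfl hg2 hgM hdep hglm hgl2 happ w

/-- **Continuity in time of the summed autocorrelation of a generator.** Under (M), (L) for `a`
and the continuity of the two-point functions `t ↦ ∫ a · (a ∘ τ_x ∘ φ_t) dμ` (for the chain: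
`InfiniteChainCorrelationContinuity`, `InfiniteChainTwoPointContinuity`), the function
`t ↦ ∫ Cov_μ(a, (a ∘ φ_t) ∘ τ_x) d(count x) = Σ_x Cov_μ(a, (a ∘ φ_t) ∘ τ_x)` is continuous on `ℝ`
(locally uniformly dominated series of continuous functions). [folklore] -/
theorem continuous_integral_count_cov_flow (hcar : D.carrier = P.bmGood)
    (hid : ∀ (t : ℝ) (σ : ChainConfig), σ ∉ P.bmGood → D.flow t σ = σ) (hU0 : ∀ r, 0 ≤ P.U r)
    (hV0 : ∀ r, 0 ≤ P.V r) {μ : Measure ChainConfig} [IsProbabilityMeasure μ]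
    (hτ : ∀ x : ℤ, MeasurePreserving (chainShift x) μ μ) (hD : D.PreservesMeasure μ)
    {C m : ℝ} (hC : 0 ≤ C) (hm : 0 < m)
    (hmix : ∀ (a : ℤ) (n : ℕ) (f g : ChainConfig → ℝ),
      DependsOn f {i : ℤ | i ≤ a} → DependsOn g {i : ℤ | a + n ≤ i} → Measurable f → Measurable g →
      MemLp f 2 μ → MemLp g 2 μ →
      |∫ σ, f σ * g σ ∂μ - (∫ σ, f σ ∂μ) * ∫ σ, g σ ∂μ| ≤
        C * Real.exp (-(m * n)) * (∫ σ, f σ ^ 2 ∂μ) ^ (1 / 2 : ℝ) * (∫ σ, g σ ^ 2 ∂μ) ^ (1 / 2 : ℝ))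
    {a : ChainConfig → ℝ} (ham : Measurable a) (had : DependsOn a (Icc (-1 : ℤ) 1)) (ha2 : MemLp a 2 μ)
    (hloc : ∀ τ : ℝ, 0 ≤ τ → ∃ ε : ℕ → ℝ, (∀ n, 0 ≤ ε n) ∧ Summable ε ∧ ∀ t : ℝ, |t| ≤ τ → ∀ n : ℕ,
        ∃ g : ChainConfig → ℝ, DependsOn g (Icc (-(n : ℤ) - 1) (n + 1)) ∧ Measurable g ∧
          MemLp g 2 μ ∧ Real.sqrt (∫ σ, (a (D.flow t σ) - g σ) ^ 2 ∂μ) ≤ ε n)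
    (hcont : ∀ x : ℤ, Continuous fun t : ℝ => ∫ σ, a σ * a (chainShift x (D.flow t σ)) ∂μ) :
    Continuous fun t : ℝ =>
      ∫ x, cov[a, (a ∘ D.flow t) ∘ chainShift x; μ] ∂(Measure.count : Measure ℤ) := by
  -- the terms, rewritten with `τ_x ∘ φ_t = φ_t ∘ τ_x`
  have hterm : ∀ (t : ℝ) (x : ℤ), cov[a, (a ∘ D.flow t) ∘ chainShift x; μ] =
      (∫ σ, a σ * a (chainShift x (D.flow t σ)) ∂μ) - (∫ σ, a σ ∂μ) * ∫ σ, a (chainShift x σ) ∂μ := by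
    intro t x
    have hpt : (a ∘ D.flow t) ∘ chainShift x = (a ∘ chainShift x) ∘ D.flow t := by
      funext σ
      simp only [comp_apply]
      rw [D.flow_chainShift_of_eq_id hcar hid hU0 hV0 t x σ]
    have hax2 : MemLp (a ∘ chainShift x) 2 μ := ha2.comp_measurePreserving (hτ x)
    have haxt2 : MemLp ((a ∘ chainShift x) ∘ D.flow t) 2 μ := hax2.comp_measurePreserving (hD.2 t)
    rw [hpt, covariance_eq_sub ha2 haxt2]
    have hmean : ∫ σ, ((a ∘ chainShift x) ∘ D.flow t) σ ∂μ = ∫ σ, a (chainShift x σ) ∂μ := by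
      have hm' : AEStronglyMeasurable (a ∘ chainShift x) (μ.map (D.flow t)) := by
        rw [(hD.2 t).map_eq]
        exact (ham.comp (chainShift.measurable x)).aestronglyMeasurable
      have h := integral_map (hD.2 t).measurable.aemeasurable hm'
      rw [(hD.2 t).map_eq] at h
      exact h.symm
    rw [hmean]
    rfl
  have hterm_cont : ∀ x : ℤ, Continuous fun t : ℝ => cov[a, (a ∘ D.flow t) ∘ chainShift x; μ] := by
    intro x
    simp only [hterm]
    exact (hcont x).sub continuous_const
  -- integrability of the terms at every time (summable majorant with `τ = |t|`)
  have hint : ∀ t : ℝ, Integrable (fun x : ℤ => cov[a, (a ∘ D.flow t) ∘ chainShift x; μ])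
      (Measure.count : Measure ℤ) := by
    intro t
    obtain ⟨F, hF, hb⟩ := D.exists_summable_majorant_cov_flow hτ hD hC hm hmix ham had ha2
      (hloc |t| (abs_nonneg t))
    rw [integrable_count_iff]
    refine Summable.of_nonneg_of_le (fun w => norm_nonneg _) (fun w => ?_) hF
    rw [Real.norm_eq_abs]
    exact hb t le_rfl w
  -- the integral over the counting measure is the sum of the series
  have hsum : ∀ t : ℝ, ∫ x, cov[a, (a ∘ D.flow t) ∘ chainShift x; μ] ∂(Measure.count : Measure ℤ) =
      ∑' x : ℤ, cov[a, (a ∘ D.flow t) ∘ chainShift x; μ] := by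
    intro t
    rw [integral_countable (hint t)]
    simp only [count_real_singleton, one_smul]
  simp only [hsum]
  -- local uniform domination on `(-τ, τ)`, `τ = |t₀| + 1`
  refine continuous_iff_continuousAt.2 fun t₀ => ?_
  set τ : ℝ := |t₀| + 1 with hτdef
  have hτ0 : 0 ≤ τ := by positivity
  obtain ⟨F, hF, hb⟩ := D.exists_summable_majorant_cov_flow hτ hD hC hm hmix ham had ha2 (hloc τ hτ0)
  have hon : ContinuousOn (fun t : ℝ => ∑' x : ℤ, cov[a, (a ∘ D.flow t) ∘ chainShift x; μ]) (Ioo (-τ) τ) := by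
    refine continuousOn_tsum (fun x => (hterm_cont x).continuousOn) hF fun x t ht => ?_
    rw [Real.norm_eq_abs]
    exact hb t (abs_le.2 ⟨ht.1.le, ht.2.le⟩) x
  have hmem : Ioo (-τ) τ ∈ 𝓝 t₀ := by
    refine isOpen_Ioo.mem_nhds ⟨?_, ?_⟩
    · rw [hτdef]; linarith [neg_abs_le t₀]
    · rw [hτdef]; linarith [le_abs_self t₀]
  exact hon.continuousAt hmem

/-! ### §4 Assembly: transport regularity of the regular state -/

/-- **Transport regularity of a regular state from (M) + (L).** Let `U ≥ 0` be measurable and `V` an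
even non-negative polynomial of degree `≥ 2`; let `D` have carrier `𝒳₀` and be the identity off
`𝒳₀`; let `μ` be a DLR Gibbs state of `P` at temperature `T`, shift-invariant, with BM's
superstability estimate (2.3), preserved by `D`, in a regular class with at most one element
(`huniq`). Assume (M) exponential `ρ`-mixing of `μ`, (L) fixed-time `L²(μ)` locality of `j₀ ∘ φ_t`
and `h₀ ∘ φ_t` with summable rate, locally uniformly in `t`, the continuity in `t` of the two-point
functions of `j₀` and of `h₀`, and `C_μ(0) > 0`. Then the summed current autocorrelation
`C_μ(t) = Σ_x ∫ j₀ (j_x ∘ φ_t) dμ` converges absolutely at every `t` and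
`0 < ∫₀^∞ e^{-νt} C_μ(t) dt` for every `ν > 0` (Doyon's zero-wavenumber space built from the
clustering of §2, strong continuity of its Koopman group from §3, then
`ZeroWavenumberData.transportRegular_of_regular_unique`). [folklore] -/
theorem transportRegular_of_mixing_of_locality {s₂ : ℕ} (h₂ : 1 ≤ s₂) (hU0 : ∀ r, 0 ≤ P.U r)
    (hUm : Measurable P.U) (hV : OscillatorChain.IsEvenPolyOfDegree P.V s₂)
    (hcar : D.carrier = P.bmGood)
    (hid : ∀ (t : ℝ) (σ : ChainConfig), σ ∉ P.bmGood → D.flow t σ = σ)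
    {T : ℝ} {μ : Measure ChainConfig} (hG : P.IsChainGibbsMeasure T μ) (hS : IsShiftInvariant μ)
    (hss : P.HasSuperstabilityEstimate μ) (hD : D.PreservesMeasure μ)
    (huniq : ∀ μ₁ μ₂ : Measure ChainConfig,
      P.IsChainGibbsMeasure T μ₁ → IsShiftInvariant μ₁ → P.HasSuperstabilityEstimate μ₁ →
      P.IsChainGibbsMeasure T μ₂ → IsShiftInvariant μ₂ → P.HasSuperstabilityEstimate μ₂ → μ₁ = μ₂)
    (hmix : ∃ C m : ℝ, 0 < m ∧ ∀ (a : ℤ) (n : ℕ) (f g : ChainConfig → ℝ),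
      DependsOn f {i : ℤ | i ≤ a} → DependsOn g {i : ℤ | a + n ≤ i} → Measurable f → Measurable g →
      MemLp f 2 μ → MemLp g 2 μ →
      |∫ σ, f σ * g σ ∂μ - (∫ σ, f σ ∂μ) * ∫ σ, g σ ∂μ| ≤
        C * Real.exp (-(m * n)) * (∫ σ, f σ ^ 2 ∂μ) ^ (1 / 2 : ℝ) * (∫ σ, g σ ^ 2 ∂μ) ^ (1 / 2 : ℝ))
    (hloc : ∀ a ∈ ({fun σ => P.bondCurrentZ σ 0, fun σ => P.energyDensityZ σ 0} : Set (ChainConfig → ℝ)),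
      ∀ τ : ℝ, 0 ≤ τ → ∃ ε : ℕ → ℝ, (∀ n, 0 ≤ ε n) ∧ Summable ε ∧ ∀ t : ℝ, |t| ≤ τ → ∀ n : ℕ,
        ∃ g : ChainConfig → ℝ, DependsOn g (Icc (-(n : ℤ) - 1) (n + 1)) ∧ Measurable g ∧
          MemLp g 2 μ ∧ Real.sqrt (∫ σ, (a (D.flow t σ) - g σ) ^ 2 ∂μ) ≤ ε n)
    (hcontj : ∀ x : ℤ, Continuous fun t : ℝ =>
      ∫ σ, P.bondCurrentZ σ 0 * P.bondCurrentZ (chainShift x (D.flow t σ)) 0 ∂μ)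
    (hconth : ∀ x : ℤ, Continuous fun t : ℝ =>
      ∫ σ, P.energyDensityZ σ 0 * P.energyDensityZ (chainShift x (D.flow t σ)) 0 ∂μ)
    (h0 : 0 < D.currentCorrelation μ 0) :
    (∀ t : ℝ, D.HasAbsConvergentCorrelation μ t) ∧
      ∀ ν : ℝ, 0 < ν → 0 < ∫ t in Ioi (0 : ℝ), Real.exp (-(ν * t)) * D.currentCorrelation μ t := by
  haveI : IsProbabilityMeasure μ := hss.1
  have hV0 : ∀ r, 0 ≤ P.V r := hV.choose_spec.2.2
  have hVm : Measurable P.V := hV.continuous.measurable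
  have hτ : ∀ x : ℤ, MeasurePreserving (chainShift x) μ μ := hS.measurePreserving_chainShift
  -- the mixing constant may be taken non-negative
  obtain ⟨C, m, hm, hmix⟩ := hmix
  have hmix' : ∀ (a : ℤ) (n : ℕ) (f g : ChainConfig → ℝ),
      DependsOn f {i : ℤ | i ≤ a} → DependsOn g {i : ℤ | a + n ≤ i} → Measurable f → Measurable g →
      MemLp f 2 μ → MemLp g 2 μ →
      |∫ σ, f σ * g σ ∂μ - (∫ σ, f σ ∂μ) * ∫ σ, g σ ∂μ| ≤
        max C 0 * Real.exp (-(m * n)) * (∫ σ, f σ ^ 2 ∂μ) ^ (1 / 2 : ℝ) *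
          (∫ σ, g σ ^ 2 ∂μ) ^ (1 / 2 : ℝ) := by
    intro a n f g h1 h2 h3 h4 h5 h6
    refine (hmix a n f g h1 h2 h3 h4 h5 h6).trans ?_
    have hA : 0 ≤ (∫ σ, f σ ^ 2 ∂μ) ^ (1 / 2 : ℝ) :=
      Real.rpow_nonneg (integral_nonneg fun _ => sq_nonneg _) _
    have hB : 0 ≤ (∫ σ, g σ ^ 2 ∂μ) ^ (1 / 2 : ℝ) :=
      Real.rpow_nonneg (integral_nonneg fun _ => sq_nonneg _) _
    have hE : 0 ≤ Real.exp (-(m * n)) := Real.exp_nonneg _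
    have : C * Real.exp (-(m * n)) ≤ max C 0 * Real.exp (-(m * n)) :=
      mul_le_mul_of_nonneg_right (le_max_left _ _) hE
    exact mul_le_mul_of_nonneg_right (mul_le_mul_of_nonneg_right this hA) hB
  have hC : 0 ≤ max C 0 := le_max_right _ _
  -- §2: the zero-wavenumber data
  have hclust := D.integrable_cov_generators h₂ hU0 hUm hV hcar hid hS hss hD hC hm hmix' hloc
  obtain ⟨Z, hZμ, hZV, -⟩ :=
    D.exists_zeroWavenumberData_of_clustering h₂ hU0 hUm hV hcar hid hS hss hD hclust
  subst hZμ
  -- §3: strong continuity of the Koopman group from the two generators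
  have hcj := D.continuous_integral_count_cov_flow hcar hid hU0 hV0 hτ hD hC hm hmix'
    (measurable_bondCurrentZ P 0) P.dependsOn_bondCurrentZ_zero
    (hss.memLp_bondCurrentZ h₂ hU0 hUm hV 0 ENNReal.ofNat_ne_top)
    (hloc _ (Set.mem_insert _ _)) hcontj
  have hch := D.continuous_integral_count_cov_flow hcar hid hU0 hV0 hτ hD hC hm hmix'
    (P.measurable_energyDensityZ hUm hVm 0) P.dependsOn_energyDensityZ_zero
    (hss.memLp_energyDensityZ hU0 hV0 hUm hVm 0 ENNReal.ofNat_ne_top)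
    (hloc _ (Set.mem_insert_of_mem _ (Set.mem_singleton _))) hconth
  have hU : Z.toFluctuationDynamics.IsStronglyContinuous := by
    refine Z.isStronglyContinuous_of_generators (le_of_eq hZV) ?_ ?_
    · exact hcj.continuousAt
    · exact hch.continuousAt
  -- §4: the reduction
  exact Z.transportRegular_of_regular_unique hG hS hss huniq hU h0

end InfiniteChainDynamics

end Literature.MathematicalPhysics.KineticTheory.HeatConduction

end
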